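import Summits.Ventures.HodgeRepro.QuadEngine
import Summits.Ventures.HodgeRepro.Faces

/-!
# From the engine check to the `Finset` vocabulary: single-class `SumTwo` quadruples have a conjugate pair

Blind re-derivation cell `pub-hodge-repro`, seat `typer` (gen 5).  Bridge between the `Finset G`
vocabulary of `CMType.lean` / `Primitive.lean` / `Faces.lean` (`IsCMType`, `rmul`, `SumTwo`) and the
bit-mask vocabulary of the sealer's engine along an enumeration `e : G ≃ Fin n`:

* `maskOf e S` — the mask of a subset (`Nat.ofBits`), `mem_maskOf`, `maskOf_injective`;
* `maskOf_rmul` — right translation is the engine's `twist` on the table `tableOf e c`;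
* `maskOf_smul_conj` — the conjugate of a CM type is the complement mask;
* `maskOf_mem_cmTypes` — CM types go to `Γ.cmTypes`; `sumTwoMasks_of_sumTwo` — `SumTwo` transfers;
* **`exists_conj_of_sumTwo`** — if `QuadEngine.noSingleClassSumTwo (tableOf e c) = true`, then for
  every CM type `Φ` and all `g₁ g₂ g₃`, a `SumTwo` quadruple `Φ, Φ·g₁, Φ·g₂, Φ·g₃` has two
  conjugate corners.  The concrete groups: `QuadFinset12.lean` (rows `QuadRows12.lean`,
  `QuadRows8.lean`).
-/

set_option autoImplicit false

open Finset
open scoped Pointwise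
open Summit.Ventures.HodgeRepro.FaceCensus

namespace HodgeRepro

namespace QuadEngine

variable {G : Type*} [DecidableEq G] {n : ℕ}

/-! ### Masks of subsets along an enumeration -/

/-- The mask of a subset `S ⊆ G` along `e : G ≃ Fin n`: bit `i` is set iff `e.symm i ∈ S`. -/
def maskOf (e : G ≃ Fin n) (S : Finset G) : ℕ := Nat.ofBits fun i : Fin n => decide (e.symm i ∈ S)

/-- Membership in `maskOf`. -/
theorem mem_maskOf (e : G ≃ Fin n) (S : Finset G) (i : Fin n) :
    mem i (maskOf e S) = decide (e.symm i ∈ S) := by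
  show (maskOf e S).testBit i.val = _
  unfold maskOf
  rw [Nat.testBit_ofBits, dif_pos i.isLt]

/-- `maskOf` is a mask. -/
theorem maskOf_lt (e : G ≃ Fin n) (S : Finset G) : maskOf e S < 2 ^ n :=
  Nat.ofBits_lt_two_pow _

/-- `maskOf` is injective. -/
theorem maskOf_injective (e : G ≃ Fin n) {S S' : Finset G} (h : maskOf e S = maskOf e S') :
    S = S' := by
  ext x
  have hx := congrArg (fun T => mem (e x) T) h
  simp only [mem_maskOf, Equiv.symm_apply_apply, decide_eq_decide] at hx
  exact hx

/-- A bit of `maskOf` as a `mem` (for `i < n`). -/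
theorem testBit_maskOf (e : G ≃ Fin n) (S : Finset G) {i : ℕ} (hi : i < n) :
    (maskOf e S).testBit i = decide (e.symm ⟨i, hi⟩ ∈ S) :=
  mem_maskOf e S ⟨i, hi⟩

/-- `SumTwo` transfers to `sumTwoMasks` on the four masks. -/
theorem sumTwoMasks_of_sumTwo (e : G ≃ Fin n) (T : Fin 4 → Finset G) (h : SumTwo T) :
    sumTwoMasks n [maskOf e (T 0), maskOf e (T 1), maskOf e (T 2), maskOf e (T 3)] = true := by
  unfold sumTwoMasks
  rw [List.all_eq_true]
  intro i _
  rw [length_filter_four]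
  simp only [mem_maskOf]
  have hx := h (e.symm i)
  rw [Finset.card_filter, Fin.sum_univ_four] at hx
  by_cases h0 : e.symm i ∈ T 0 <;> by_cases h1 : e.symm i ∈ T 1 <;> by_cases h2 : e.symm i ∈ T 2 <;>
    by_cases h3 : e.symm i ∈ T 3 <;> simp [h0, h1, h2, h3] at hx ⊢

variable [Group G]

/-- The conjugate of a CM type is the complement mask. -/
theorem maskOf_smul_conj [Fintype G] (e : G ≃ Fin n) {c : G} (hc : IsComplexConj c) {S : Finset G}
    (hS : IsCMType c S) : maskOf e (c • S) = full n ^^^ maskOf e S := by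
  rw [hS.smul_eq_compl hc]
  apply Nat.eq_of_testBit_eq
  intro i
  rw [Nat.testBit_xor, testBit_full]
  by_cases hi : i < n
  · rw [testBit_maskOf e _ hi, testBit_maskOf e _ hi]
    simp [hi, Finset.mem_compl]
  · have hi' : n ≤ i := Nat.le_of_not_lt hi
    rw [testBit_eq_false_of_le (maskOf_lt e _) hi', testBit_eq_false_of_le (maskOf_lt e _) hi']
    simp [hi]

/-- Right translation is the engine's twist on the Cayley table. -/
theorem maskOf_rmul (e : G ≃ Fin n) (c : G) (S : Finset G) (g : G) :
    maskOf e (rmul S g) = (tableOf e c).twist (e g) (maskOf e S) := by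
  apply Nat.eq_of_testBit_eq
  intro i
  by_cases hi : i < n
  · have h2 : ((tableOf e c).twist (e g) (maskOf e S)).testBit i =
        mem ⟨i, hi⟩ ((tableOf e c).twist (e g) (maskOf e S)) := rfl
    rw [testBit_maskOf e _ hi, h2]
    apply Bool.eq_iff_iff.2
    rw [CMGaloisType.twist, mem_imageMask, decide_eq_true_iff, mem_rmul]
    constructor
    · intro h
      refine ⟨e (e.symm ⟨i, hi⟩ * g⁻¹), ?_, ?_⟩
      · rw [mem_maskOf, Equiv.symm_apply_apply]
        exact decide_eq_true h
      · rw [tableOf_mul, Equiv.symm_apply_apply, Equiv.symm_apply_apply, inv_mul_cancel_right,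
          Equiv.apply_symm_apply]
    · rintro ⟨j, hj, hjk⟩
      rw [mem_maskOf, decide_eq_true_iff] at hj
      rw [tableOf_mul, Equiv.symm_apply_apply] at hjk
      have hk : e.symm ⟨i, hi⟩ = e.symm j * g := by rw [← hjk, Equiv.symm_apply_apply]
      rw [hk, mul_inv_cancel_right]
      exact hj
  · have hi' : n ≤ i := Nat.le_of_not_lt hi
    rw [testBit_eq_false_of_le (maskOf_lt e _) hi', testBit_eq_false_of_le (twist_lt _ _ _) hi']

/-- The mask of a CM type is in the engine's list of CM types of the table. -/
theorem maskOf_mem_cmTypes (e : G ≃ Fin n) {c : G} {S : Finset G} (hS : IsCMType c S) :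
    maskOf e S ∈ (tableOf e c).cmTypes := by
  unfold CMGaloisType.cmTypes
  rw [List.mem_filter, List.mem_range]
  refine ⟨maskOf_lt e S, ?_⟩
  unfold CMGaloisType.isCMType
  rw [Bool.and_eq_true, decide_eq_true_iff, List.all_eq_true]
  refine ⟨maskOf_lt e S, fun i _ => ?_⟩
  rw [tableOf_mul, tableOf_conj, mem_maskOf, mem_maskOf]
  simp only [Equiv.symm_apply_apply]
  by_cases h : e.symm i ∈ S <;> simp [h, hS.conj_mem_iff]

/-! ### The transfer -/

/-- The quadruple `Φ, Φ·g₁, Φ·g₂, Φ·g₃` of right translates. -/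
def transQuad (Φ : Finset G) (g₁ g₂ g₃ : G) : Fin 4 → Finset G :=
  ![Φ, rmul Φ g₁, rmul Φ g₂, rmul Φ g₃]

omit [DecidableEq G] in
/-- Every corner of `transQuad` of a CM type is a CM type. -/
theorem isCMType_transQuad {c : G} {Φ : Finset G} (hΦ : IsCMType c Φ) (g₁ g₂ g₃ : G) (i : Fin 4) :
    IsCMType c (transQuad Φ g₁ g₂ g₃ i) := by
  fin_cases i
  · exact hΦ
  · exact hΦ.rmul g₁
  · exact hΦ.rmul g₂
  · exact hΦ.rmul g₃

/-- The masks of the corners of `transQuad`. -/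
theorem maskOf_transQuad (e : G ≃ Fin n) (c : G) (Φ : Finset G) (g₁ g₂ g₃ : G) :
    [maskOf e (transQuad Φ g₁ g₂ g₃ 0), maskOf e (transQuad Φ g₁ g₂ g₃ 1),
      maskOf e (transQuad Φ g₁ g₂ g₃ 2), maskOf e (transQuad Φ g₁ g₂ g₃ 3)] =
    [maskOf e Φ, (tableOf e c).twist (e g₁) (maskOf e Φ), (tableOf e c).twist (e g₂) (maskOf e Φ),
      (tableOf e c).twist (e g₃) (maskOf e Φ)] := by
  simp only [transQuad, Matrix.cons_val_zero, Matrix.cons_val_one, Matrix.head_cons,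
    Matrix.cons_val_two, Matrix.tail_cons, Matrix.cons_val_three, maskOf_rmul e c]

/-- **Transfer.**  If the engine check passes on the Cayley table of `(G, c)`, then for every CM type
`Φ` and all `g₁ g₂ g₃`, a `SumTwo` quadruple `Φ, Φ·g₁, Φ·g₂, Φ·g₃` has two conjugate corners. -/
theorem exists_conj_of_sumTwo [Fintype G] (e : G ≃ Fin n) {c : G} (hc : IsComplexConj c)
    (hΓ : noSingleClassSumTwo (tableOf e c) = true) {Φ : Finset G} (hΦ : IsCMType c Φ)
    (g₁ g₂ g₃ : G) (hs : SumTwo (transQuad Φ g₁ g₂ g₃)) :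
    ∃ i j : Fin 4, transQuad Φ g₁ g₂ g₃ j = c • transQuad Φ g₁ g₂ g₃ i := by
  have hm := sumTwoMasks_of_sumTwo e _ hs
  rw [maskOf_transQuad e c] at hm
  have hcp := hasConjPair_of_sumTwo (tableOf e c) hΓ (maskOf_mem_cmTypes e hΦ) (e g₁) (e g₂) (e g₃)
    hm
  rw [← maskOf_transQuad e c] at hcp
  unfold hasConjPair at hcp
  rw [List.any_eq_true] at hcp
  obtain ⟨X, hX, hX'⟩ := hcp
  rw [List.contains_iff_mem] at hX'
  have key : ∀ Y, Y ∈ [maskOf e (transQuad Φ g₁ g₂ g₃ 0), maskOf e (transQuad Φ g₁ g₂ g₃ 1),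
      maskOf e (transQuad Φ g₁ g₂ g₃ 2), maskOf e (transQuad Φ g₁ g₂ g₃ 3)] →
      ∃ i : Fin 4, Y = maskOf e (transQuad Φ g₁ g₂ g₃ i) := by
    intro Y hY
    simp only [List.mem_cons, List.mem_nil_iff, or_false] at hY
    rcases hY with rfl | rfl | rfl | rfl
    · exact ⟨0, rfl⟩
    · exact ⟨1, rfl⟩
    · exact ⟨2, rfl⟩
    · exact ⟨3, rfl⟩
  obtain ⟨i, rfl⟩ := key X hX
  obtain ⟨j, hj⟩ := key _ hX'
  refine ⟨i, j, maskOf_injective e ?_⟩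
  rw [← hj, maskOf_smul_conj e hc (isCMType_transQuad hΦ g₁ g₂ g₃ i)]

end QuadEngine

end HodgeRepro
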